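import Summits.RiemannHypothesis.RiemannHypothesis.Theorems.HandoffDodgerFarTailGrid
import Summits.RiemannHypothesis.RiemannHypothesis.Theorems.HandoffDodgerHorizonChoice
import HarnessLib

/-!
# HANDOFF — the FAR-ZONE COST of the dodger by Stieltjes integration: `Σ_ρ m(ρ) e^{−a/γ²}/γ² ≤ (0.1615·log √a − 0.11)/√a` for `a ≥ e¹⁶` (rh-explicit, track «HANDOFF», seat prove-2 gen14, ATTEMPT-24 §1, brick FT part 5)

HONEST FRAMING. Nothing here bears on the truth of RH; this is zero COUNTING (RH-free upper-side bookkeeping of the dodger's far-zone cost). **`far_cost_le_sharp`**: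
for `a ≥ e¹⁶` and every finite set of zeros of `ζ` in the upper critical strip,
`Σ_ρ m(ρ) e^{−a/(Im ρ)²}/(Im ρ)² ≤ (0.1615·log √a − 0.11)/√a` — the SHAPE of the tree's `HandoffDodgerFarCost.far_cost_le`
(`N(√a)/(e·a) + B(0,√a) ≈ (110·log a + 220)/√a`, unit-window counting) with the Stieltjes constant of ATTEMPT-16 Lemma C3
(paper: `(0.0705·log a − 0.10)/√a`; here `(0.081·log a − 0.11)/√a`), i.e. `≈ 680×` smaller at `a ≈ 10¹⁰`; uniform in the truncation,
as the zero-side domination `re_weilQuadratic_le_of_zeroSum_le` requires. Ingredients: below `√a/4` the weight is `≤ 16e^{−16}/a` on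
`≤ N(√a/4) ≤ (√a/4)log √a` zeros (`zetaZeroCount_le_mul_log`); above, `far_stieltjes_le` + `integral_farDensity_le` +
`integral_hswErrDeriv_farWeight_le`. This is brick FT of the «dodger-down» programme (HOME/rh-explicit-dodger-p2/DODGER-STAGE2-PLAN.md §2 (c)):
MODEL floor of the RH-free gap-blind upper clause `1015 → ≈ 620` (with PF: `≈ 450`). No `sorry`, standard axioms, no definitions.

References: this track (HOME/handoff/prove-2/ATTEMPT-16.md §4 Lemma C3; ATTEMPT-24.md §1). Hasanalizade–Shen–Wong 2022 Cor. 1.2 (tree).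
-/

set_option linter.dupNamespace false

noncomputable section

open Real Finset MeasureTheory intervalIntegral Set

namespace Summit.RiemannHypothesis.RiemannHypothesis.Theorems.Handoff

open Literature.NumberTheory.LFunctions Literature.NumberTheory.LFunctions.SchoenfeldBound
  Literature.NumberTheory.LFunctions.KadiriTail

/-! ## The far cost, sharp form -/

/-- **The FAR-ZONE COST of the dodger by Stieltjes integration (ATTEMPT-16 Lemma C3 with explicit constants, kernel).** For `a ≥ e¹⁶` and
every finite set `s` of zeros of `ζ` in the upper critical strip,
`Σ_{ρ ∈ s} m(ρ)·e^{−a/(Im ρ)²}/(Im ρ)² ≤ (0.1615·log √a − 0.11)/√a`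
(uniform in `s`). Below `√a/4` the weight is at most `16e^{−16}/a` and there are `≤ N(√a/4)` zeros; above, `far_stieltjes_le` with
`X₁ = √a/4`, the grid bound `integral_farDensity_le` and `integral_hswErrDeriv_farWeight_le`. The tree's crude form
`HandoffDodgerFarCost.far_cost_le` (`N(√a)/(e·a) + B(0,√a)`, i.e. `≈ (110·log a + 220)/√a`) is `≈ 680×` larger at `a ≈ 10¹⁰`.
RH-free zero counting. [this track, ATTEMPT-16 Lemma C3; ATTEMPT-24 §1] -/
theorem far_cost_le_sharp {a : ℝ} (ha : Real.exp 16 ≤ a) (s : Finset ℂ)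
    (hs : ∀ ρ ∈ s, riemannZeta ρ = 0 ∧ 0 ≤ ρ.re ∧ ρ.re ≤ 1 ∧ 0 < ρ.im) :
    ∑ ρ ∈ s, (riemannZetaZeroOrder ρ : ℝ) * (Real.exp (-a / ρ.im ^ 2) / ρ.im ^ 2) ≤
      (0.1615 * Real.log (Real.sqrt a) - 0.11) / Real.sqrt a := by
  classical
  have ha0 : 0 < a := lt_of_lt_of_le (Real.exp_pos 16) ha
  set X : ℝ := Real.sqrt a with hXdef
  have hXa : X ^ 2 = a := Real.sq_sqrt ha0.le
  have h16 : Real.exp 16 = Real.exp 8 ^ 2 := by rw [← Real.exp_nat_mul]; norm_num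
  have hX8 : Real.exp 8 ≤ X := by
    have h := Real.sqrt_le_sqrt ha
    rwa [h16, Real.sqrt_sq (Real.exp_pos 8).le] at h
  have he8 : (2980 : ℝ) ≤ Real.exp 8 := by
    have h : Real.exp 8 = Real.exp 1 ^ 8 := by rw [← Real.exp_nat_mul]; norm_num
    rw [h]
    have := Real.exp_one_gt_d9
    nlinarith [pow_le_pow_left₀ (by norm_num : (0:ℝ) ≤ 2.7182818283) this.le 8]
  have hX0 : 0 < X := by linarith
  have he1 : Real.exp 1 < 3 := by have := Real.exp_one_lt_d9; linarith
  have heX4 : Real.exp 1 ≤ X * (1 / 4) := by linarith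
  have heX : Real.exp 1 ≤ X := by linarith
  have hℓ : 8 ≤ Real.log X := by rw [Real.le_log_iff_exp_le hX0]; exact hX8
  -- rewrite the weight with `a = X²`
  rw [← hXa]
  -- the height `T₂` dominating `s` and `8X`
  set T₂ : ℝ := X * 8 + ∑ ρ ∈ s, ρ.im with hT₂
  have him0 : ∀ ρ ∈ s, 0 ≤ ρ.im := fun ρ hρ => (hs ρ hρ).2.2.2.le
  have hsum0 : 0 ≤ ∑ ρ ∈ s, ρ.im := Finset.sum_nonneg him0
  have hT8 : X * 8 ≤ T₂ := by rw [hT₂]; linarith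
  have hXT : X ≤ T₂ := by nlinarith
  have himT : ∀ ρ ∈ s, ρ.im ≤ T₂ := fun ρ hρ => by
    have h := Finset.single_le_sum him0 hρ
    rw [hT₂]; nlinarith
  have hm0 : ∀ ρ ∈ s, (0 : ℝ) ≤ riemannZetaZeroOrder ρ := fun ρ hρ ↦ by
    obtain ⟨hz, -, -, him⟩ := hs ρ hρ
    exact_mod_cast zero_le_one.trans (ZetaZeros.riemannZetaNontrivialZeros.one_le_order
      (ZetaZeros.riemannZetaNontrivialZeros.mem_of_im_ne_zero hz him.ne'))
  have hw0 : ∀ t : ℝ, 0 ≤ Real.exp (-X ^ 2 / t ^ 2) / t ^ 2 := fun t => by positivity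
  -- split `s` at the height `X/4`
  rw [← sum_filter_add_sum_filter_not s (fun ρ ↦ ρ.im ≤ X * (1 / 4))]
  ----------------------------------------------------------------
  -- PART 1: the zeros below `X/4`
  have hwX4 : Real.exp (-X ^ 2 / (X * (1 / 4)) ^ 2) / (X * (1 / 4)) ^ 2 = 16 * Real.exp (-16) / X ^ 2 := by
    have e1 : -X ^ 2 / (X * (1 / 4)) ^ 2 = -16 := by field_simp; ring
    rw [e1]; field_simp; ring
  have he16 : Real.exp (-16) ≤ 2e-7 := by
    have h1 : Real.exp (-16) = Real.exp (-1) ^ 16 := by rw [← Real.exp_nat_mul]; norm_num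
    have h2 : Real.exp (-1) ≤ 0.37 := by have := Real.exp_neg_one_lt_d9; linarith
    rw [h1]
    calc Real.exp (-1) ^ 16 ≤ (0.37 : ℝ) ^ 16 := pow_le_pow_left₀ (Real.exp_pos _).le h2 16
      _ ≤ 2e-7 := by norm_num
  have hN4 : (zetaZeroCount (X * (1 / 4)) : ℝ) ≤ X * (1 / 4) * Real.log X := by
    have h1 := zetaZeroCount_le_mul_log (x := X * (1 / 4)) (by linarith)
    have h2 : Real.log (X * (1 / 4)) ≤ Real.log X := Real.log_le_log (by positivity) (by linarith)
    exact h1.trans (mul_le_mul_of_nonneg_left h2 (by positivity))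
  have hP1 : ∑ ρ ∈ s.filter (fun ρ ↦ ρ.im ≤ X * (1 / 4)),
      (riemannZetaZeroOrder ρ : ℝ) * (Real.exp (-X ^ 2 / ρ.im ^ 2) / ρ.im ^ 2) ≤ 8e-7 * (Real.log X / X) := by
    calc ∑ ρ ∈ s.filter (fun ρ ↦ ρ.im ≤ X * (1 / 4)), (riemannZetaZeroOrder ρ : ℝ) * (Real.exp (-X ^ 2 / ρ.im ^ 2) / ρ.im ^ 2)
        ≤ ∑ ρ ∈ s.filter (fun ρ ↦ ρ.im ≤ X * (1 / 4)), (riemannZetaZeroOrder ρ : ℝ) * (16 * Real.exp (-16) / X ^ 2) := by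
          refine sum_le_sum fun ρ hρ ↦ ?_
          obtain ⟨hρs, hle⟩ := mem_filter.1 hρ
          refine mul_le_mul_of_nonneg_left ?_ (hm0 ρ hρs)
          rw [← hwX4]
          exact farWeight_mono_below (hs ρ hρs).2.2.2 hle (by nlinarith)
      _ = (∑ ρ ∈ s.filter (fun ρ ↦ ρ.im ≤ X * (1 / 4)), (riemannZetaZeroOrder ρ : ℝ)) * (16 * Real.exp (-16) / X ^ 2) := by
          rw [sum_mul]
      _ ≤ (zetaZeroCount (X * (1 / 4)) : ℝ) * (16 * Real.exp (-16) / X ^ 2) := by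
          refine mul_le_mul_of_nonneg_right (sum_zeroOrder_le_zetaZeroCount (by positivity) _ fun ρ hρ ↦ ?_) (by positivity)
          obtain ⟨hρs, hle⟩ := mem_filter.1 hρ
          obtain ⟨hz, h1, h2, h3⟩ := hs ρ hρs
          exact ⟨hz, h1, h2, h3, hle⟩
      _ ≤ (X * (1 / 4) * Real.log X) * (16 * Real.exp (-16) / X ^ 2) := mul_le_mul_of_nonneg_right hN4 (by positivity)
      _ = 4 * Real.exp (-16) * (Real.log X / X) := by field_simp; ring
      _ ≤ 8e-7 * (Real.log X / X) := by
          have : 0 ≤ Real.log X / X := by positivity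
          nlinarith
  ----------------------------------------------------------------
  -- PART 2: the zeros above `X/4`, by Stieltjes integration
  have hsub : s.filter (fun ρ ↦ ¬ ρ.im ≤ X * (1 / 4)) ⊆ zerosBetween (X * (1 / 4)) T₂ := by
    intro ρ hρ
    obtain ⟨hρs, hgt⟩ := mem_filter.1 hρ
    obtain ⟨hz, h1, h2, h3⟩ := hs ρ hρs
    exact (mem_zerosBetween (by positivity)).2 ⟨hz, h1, h2, lt_of_not_ge hgt, himT ρ hρs⟩
  have hP2a : ∑ ρ ∈ s.filter (fun ρ ↦ ¬ ρ.im ≤ X * (1 / 4)),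
      (riemannZetaZeroOrder ρ : ℝ) * (Real.exp (-X ^ 2 / ρ.im ^ 2) / ρ.im ^ 2) ≤
      ∑ ρ ∈ zerosBetween (X * (1 / 4)) T₂, (riemannZetaZeroOrder ρ : ℝ) * (Real.exp (-X ^ 2 / ρ.im ^ 2) / ρ.im ^ 2) :=
    sum_le_sum_of_subset_of_nonneg hsub fun ρ hρ _ ↦
      mul_nonneg (zeroOrder_nonneg_of_mem_zerosBetween (by positivity) hρ) (hw0 _)
  have hSt := far_stieltjes_le heX4 (by linarith) hXT
  have hD := integral_farDensity_le hX8 hT8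
  have hE := integral_hswErrDeriv_farWeight_le heX hXT
  -- the error constant `s₁(X) ≤ 0.3611 log X + 9.3675`
  have hS : (0.1038 * Real.log X + 0.2573 * Real.log (Real.log X) + 9.3675) ≤ 0.3611 * Real.log X + 9.3675 := by
    have h := Real.log_le_sub_one_of_pos (show (0:ℝ) < Real.log X by linarith)
    linarith
  have he1' : Real.exp (-1) ≤ 0.3679 := by have := Real.exp_neg_one_lt_d9; linarith
  have hX2 : 1 / X ^ 2 ≤ (1 / 2980) * (1 / X) := by
    rw [div_le_iff₀ (by positivity)]
    have : (1 / 2980 : ℝ) * (1 / X) * X ^ 2 = X / 2980 := by field_simp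
    rw [this, le_div_iff₀ (by norm_num)]
    linarith
  have hSterm : 2 * (0.1038 * Real.log X + 0.2573 * Real.log (Real.log X) + 9.3675) * (Real.exp (-1) / X ^ 2) ≤
      8.92e-5 * (Real.log X / X) + 2.313e-3 * (1 / X) := by
    have h1 : 2 * (0.1038 * Real.log X + 0.2573 * Real.log (Real.log X) + 9.3675) * (Real.exp (-1) / X ^ 2) ≤
        2 * (0.3611 * Real.log X + 9.3675) * (0.3679 * (1 / X ^ 2)) := by
      have hS0 : 0 ≤ 0.1038 * Real.log X + 0.2573 * Real.log (Real.log X) + 9.3675 := by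
        have : 0 ≤ Real.log (Real.log X) := Real.log_nonneg (by linarith)
        positivity
      refine mul_le_mul (by linarith) ?_ (by positivity) (by positivity)
      rw [div_eq_mul_one_div]
      exact mul_le_mul_of_nonneg_right he1' (by positivity)
    have h2 : 2 * (0.3611 * Real.log X + 9.3675) * (0.3679 * (1 / X ^ 2)) ≤
        2 * (0.3611 * Real.log X + 9.3675) * (0.3679 * ((1 / 2980) * (1 / X))) :=
      mul_le_mul_of_nonneg_left (mul_le_mul_of_nonneg_left hX2 (by norm_num)) (by positivity)
    have h3 : 2 * (0.3611 * Real.log X + 9.3675) * (0.3679 * ((1 / 2980) * (1 / X))) ≤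
        8.92e-5 * (Real.log X / X) + 2.313e-3 * (1 / X) := by
      have e : 2 * (0.3611 * Real.log X + 9.3675) * (0.3679 * ((1 / 2980) * (1 / X))) =
          (2 * 0.3611 * 0.3679 / 2980) * (Real.log X / X) + (2 * 9.3675 * 0.3679 / 2980) * (1 / X) := by ring
      rw [e]
      have hu0 : 0 ≤ Real.log X / X := by positivity
      have hv0 : 0 ≤ 1 / X := by positivity
      linarith only [hu0, hv0]
    linarith only [h1, h2, h3]
  have hEterm : (0.18055 : ℝ) / X ^ 2 ≤ 6.06e-5 * (1 / X) := by
    have : (0.18055 : ℝ) / X ^ 2 = 0.18055 * (1 / X ^ 2) := by ring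
    rw [this]
    have h := mul_le_mul_of_nonneg_left hX2 (by norm_num : (0:ℝ) ≤ 0.18055)
    have hv0 : 0 ≤ 1 / X := by positivity
    linarith only [h, hv0]
  have hDterm : (0.16135 * Real.log X - 0.1143) / X = 0.16135 * (Real.log X / X) - 0.1143 * (1 / X) := by ring
  have hfin : (0.1615 * Real.log X - 0.11) / X = 0.1615 * (Real.log X / X) - 0.11 * (1 / X) := by ring
  rw [hfin]
  have hpos : 0 ≤ 1 / X := by positivity
  have hupos : 0 ≤ Real.log X / X := by positivity
  linarith only [hP1, hP2a, hSt, hD, hE, hSterm, hEterm, hDterm, hpos, hupos]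

end Summit.RiemannHypothesis.RiemannHypothesis.Theorems.Handoff

end
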